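import Mathlib
import Literature.Probability.LatticeModels.DelaunayGraph

/-!
# Fat tubes in defect-free Voronoi tessellations, Part 2: the bisector frame and the ends of an edge

Crux `Summit.CriticalPhenomena.CardyFormulaZ2.Theses.CardyFlipRusso.SquareFromVoronoiHub`
(stmt-CriticalPhenomena-6434), line `Sketch`, stub `stub_fatTube`.  Two Voronoi cells of
nuclei `b ≠ b'` meet along a segment of the perpendicular bisector of `b b'`.  We set up the
orthonormal FRAME `(c, e)` (`c` = midpoint, `e` = unit vector from `b` to `b'`, so that
`b = c - a e`, `b' = c + a e`, `a = |bb'|/2`) in which the bisector is `s ↦ c + (s I) e` and all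
distances are explicit (`dist_frame`, `dist_bis_sq`, …), and prove the key structural fact
`exists_blocker_sSup` / `exists_blocker_sInf` (registered sub-goal `stub_fatTube_part2`): if the
set `S` of bisector parameters whose point lies in the cell of `b` is closed, non-empty and
inside `(-ρ, ρ)`, and only finitely many nuclei are within `5ρ` of `b`, then at the TOP parameter
`sSup S` some nucleus `q` is tied with `b` and lies strictly ABOVE the line `b b'`
(`Im` of its frame coordinate `> 0`), and symmetrically at the bottom.  (Otherwise every
constraint would remain satisfied slightly beyond `sSup S`: the strict ones by continuity and
finiteness, the tied ones by the sign of their slope.)  The two blockers are therefore distinct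
third nuclei, to which the no-short-pseudo-edge clause (iii) applies (Part 3).
-/

noncomputable section

namespace Summit.CriticalPhenomena.CardyFormulaZ2.Cruxes.SquareFromVoronoiHub.VoronoiBlocks.Faithful

open scoped Topology ComplexConjugate Pointwise
open Set Metric
open Literature.Probability.LatticeModels (voronoiCell mem_voronoiCell_iff self_mem_voronoiCell)

/-! ### The frame -/

/-- Distances in the frame `(c, e)`, `‖e‖ = 1`, are read off the coordinates. [folklore] -/
theorem dist_frame (c e : ℂ) (he : ‖e‖ = 1) (ζ ζ' : ℂ) :
    dist (c + ζ * e) (c + ζ' * e) = ‖ζ - ζ'‖ := by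
  rw [dist_eq_norm, show c + ζ * e - (c + ζ' * e) = (ζ - ζ') * e by ring, norm_mul, he, mul_one]

/-- Every point has a coordinate in the frame. [folklore] -/
theorem eq_frame (c e : ℂ) (he : ‖e‖ = 1) (q : ℂ) : q = c + ((q - c) * conj e) * e := by
  rw [mul_assoc, Complex.conj_mul', he]; push_cast; ring

/-- The coordinate of a point given in frame form. [folklore] -/
theorem coord_frame (c e : ℂ) (he : ‖e‖ = 1) (ζ : ℂ) : (c + ζ * e - c) * conj e = ζ := by
  rw [add_sub_cancel_left, mul_assoc, Complex.mul_conj', he]; push_cast; ring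

/-- Squared distance from the bisector point of parameter `s` to the point of coordinates
`(t, κ)`. [folklore] -/
theorem dist_bis_sq (c e : ℂ) (he : ‖e‖ = 1) (s t κ : ℝ) :
    dist (c + ((s : ℂ) * Complex.I) * e) (c + ((t : ℂ) + κ * Complex.I) * e) ^ 2 =
      t ^ 2 + (s - κ) ^ 2 := by
  rw [dist_frame c e he, show (s : ℂ) * Complex.I - (t + κ * Complex.I) =
    ((-t : ℝ) : ℂ) + ((s - κ : ℝ) : ℂ) * Complex.I by push_cast; ring, Complex.sq_norm, Complex.normSq_add_mul_I]
  ring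

/-- Squared distance from the bisector point of parameter `s` to `b = c - a e`. [folklore] -/
theorem dist_bis_sub_sq (c e : ℂ) (he : ‖e‖ = 1) (s a : ℝ) :
    dist (c + ((s : ℂ) * Complex.I) * e) (c - (a : ℂ) * e) ^ 2 = a ^ 2 + s ^ 2 := by
  rw [show c - (a : ℂ) * e = c + ((-a : ℝ) : ℂ) * e by push_cast; ring, dist_frame c e he,
    show (s : ℂ) * Complex.I - ((-a : ℝ) : ℂ) = ((a : ℝ) : ℂ) + ((s : ℝ) : ℂ) * Complex.I by
      push_cast; ring, Complex.sq_norm, Complex.normSq_add_mul_I]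

/-- Squared distance from the bisector point of parameter `s` to `b' = c + a e`. [folklore] -/
theorem dist_bis_add_sq (c e : ℂ) (he : ‖e‖ = 1) (s a : ℝ) :
    dist (c + ((s : ℂ) * Complex.I) * e) (c + (a : ℂ) * e) ^ 2 = a ^ 2 + s ^ 2 := by
  rw [dist_frame c e he, show (s : ℂ) * Complex.I - (a : ℂ) = ((-a : ℝ) : ℂ) +
    ((s : ℝ) : ℂ) * Complex.I by push_cast; ring, Complex.sq_norm, Complex.normSq_add_mul_I]
  ring

/-- Bisector points are equidistant from `b` and `b'`. [folklore] -/
theorem dist_bis_sub_eq_dist_bis_add (c e : ℂ) (he : ‖e‖ = 1) (s a : ℝ) :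
    dist (c + ((s : ℂ) * Complex.I) * e) (c - (a : ℂ) * e) =
      dist (c + ((s : ℂ) * Complex.I) * e) (c + (a : ℂ) * e) := by
  rw [← sq_eq_sq₀ dist_nonneg dist_nonneg, dist_bis_sub_sq c e he, dist_bis_add_sq c e he]

/-- Distance between two bisector points. [folklore] -/
theorem dist_bis_bis (c e : ℂ) (he : ‖e‖ = 1) (s s' : ℝ) :
    dist (c + ((s : ℂ) * Complex.I) * e) (c + ((s' : ℂ) * Complex.I) * e) = |s - s'| := by
  rw [dist_frame c e he, show (s : ℂ) * Complex.I - s' * Complex.I = ((s - s' : ℝ) : ℂ) * Complex.I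
    by push_cast; ring, norm_mul, Complex.norm_I, mul_one, Complex.norm_real, Real.norm_eq_abs]

/-- A point equidistant from `b = c - a e` and `b' = c + a e` (`a ≠ 0`) has first coordinate
`0`, i.e. lies on the bisector. [folklore] -/
theorem re_eq_zero_of_dist_eq {c e : ℂ} {a : ℝ} (he : ‖e‖ = 1) (ha : a ≠ 0) (ζ : ℂ)
    (h : dist (c + ζ * e) (c - a * e) = dist (c + ζ * e) (c + a * e)) : ζ.re = 0 := by
  rw [show c - (a : ℂ) * e = c + ((-a : ℝ) : ℂ) * e by push_cast; ring, dist_frame c e he,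
    dist_frame c e he] at h
  have h1 : ‖ζ - ((-a : ℝ) : ℂ)‖ ^ 2 = (ζ.re + a) ^ 2 + ζ.im ^ 2 := by
    rw [show ζ - ((-a : ℝ) : ℂ) = ((ζ.re + a : ℝ) : ℂ) + (ζ.im : ℂ) * Complex.I by
      conv_lhs => rw [← Complex.re_add_im ζ]
      push_cast; ring, Complex.sq_norm, Complex.normSq_add_mul_I]
  have h2 : ‖ζ - (a : ℂ)‖ ^ 2 = (ζ.re - a) ^ 2 + ζ.im ^ 2 := by
    rw [show ζ - (a : ℂ) = ((ζ.re - a : ℝ) : ℂ) + (ζ.im : ℂ) * Complex.I by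
      conv_lhs => rw [← Complex.re_add_im ζ]
      push_cast; ring, Complex.sq_norm, Complex.normSq_add_mul_I]
  have h3 : (ζ.re + a) ^ 2 + ζ.im ^ 2 = (ζ.re - a) ^ 2 + ζ.im ^ 2 := by rw [← h1, ← h2, h]
  have h4 : 4 * a * ζ.re = 0 := by linarith only [h3]
  rcases mul_eq_zero.1 h4 with h5 | h5
  · exact absurd (by linarith only [h5] : a = 0) ha
  · exact h5

/-! ### The ends of an edge are blocked by third nuclei -/

/-- **Top blocker.**  Frame `(c, e)`, `b = c - a e` with `|a| < ρ`; let `S` be the (closed,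
non-empty) set of parameters `s ∈ (-ρ, ρ)` whose bisector point `c + (s I) e` lies in the cell
of `b`, and assume only finitely many nuclei lie within `5ρ` of `b`.  Then at the top parameter
`sSup S` some nucleus `q` is tied with `b` and has frame coordinate with POSITIVE imaginary part
(in particular `q ≠ b, b'`). [folklore] -/
theorem exists_blocker_sSup {X : Set ℂ} {ρ a : ℝ} {c e : ℂ} (he : ‖e‖ = 1) (hρ : 0 < ρ)
    (ha : |a| < ρ) (hfin : (X ∩ closedBall (c - a * e) (5 * ρ)).Finite) (S : Set ℝ)
    (hS : S = {s : ℝ | c + ((s : ℂ) * Complex.I) * e ∈ voronoiCell X (c - a * e)})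
    (hSρ : ∀ s ∈ S, |s| < ρ) (hne : S.Nonempty) (hcl : IsClosed S) :
    ∃ q ∈ X, dist (c + (((sSup S : ℝ) : ℂ) * Complex.I) * e) q =
      dist (c + (((sSup S : ℝ) : ℂ) * Complex.I) * e) (c - a * e) ∧ 0 < ((q - c) * conj e).im := by
  set b : ℂ := c - a * e with hb
  set zL : ℝ → ℂ := fun s => c + ((s : ℂ) * Complex.I) * e with hzL
  have hzc : Continuous zL :=
    continuous_const.add ((Complex.continuous_ofReal.mul continuous_const).mul continuous_const)
  have hbdd : BddAbove S := ⟨ρ, fun s hs => (abs_lt.1 (hSρ s hs)).2.le⟩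
  set sp := sSup S with hsp_def
  have hspS : sp ∈ S := hcl.csSup_mem hne hbdd
  have hspρ : |sp| < ρ := hSρ sp hspS
  have hcell : zL sp ∈ voronoiCell X b := by
    have h := hspS; rw [hS] at h; exact h
  by_contra H
  push Not at H
  set Qs : Set ℂ := {q | q ∈ X ∩ closedBall b (5 * ρ) ∧ dist (zL sp) b < dist (zL sp) q} with hQs
  have hQsfin : Qs.Finite := hfin.subset fun q hq => hq.1
  have hUo : IsOpen (⋂ q ∈ Qs, {s : ℝ | dist (zL s) b < dist (zL s) q}) :=
    hQsfin.isOpen_biInter fun q _ =>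
      isOpen_lt (hzc.dist continuous_const) (hzc.dist continuous_const)
  have hspU : sp ∈ ⋂ q ∈ Qs, {s : ℝ | dist (zL s) b < dist (zL s) q} :=
    mem_iInter₂.2 fun q hq => hq.2
  obtain ⟨ε, hε, hεU⟩ := Metric.isOpen_iff.1 hUo sp hspU
  set δ : ℝ := min (ε / 2) ((ρ - sp) / 2) with hδ
  have hδpos : 0 < δ := lt_min (by linarith) (by linarith [(abs_lt.1 hspρ).2])
  have hδε : δ ≤ ε / 2 := min_le_left _ _
  have hδρ : δ ≤ (ρ - sp) / 2 := min_le_right _ _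
  have hs'ρ : |sp + δ| < ρ := abs_lt.2 ⟨by linarith [(abs_lt.1 hspρ).1], by linarith⟩
  have hs'U : sp + δ ∈ ball sp ε := by
    rw [mem_ball, Real.dist_eq, show sp + δ - sp = δ by ring, abs_of_pos hδpos]; linarith
  have hs'S : sp + δ ∈ S := by
    rw [hS]
    intro q hq
    show dist (zL (sp + δ)) b ≤ dist (zL (sp + δ)) q
    have hzb : dist (zL (sp + δ)) b ^ 2 = a ^ 2 + (sp + δ) ^ 2 := dist_bis_sub_sq c e he _ a
    have hzb' : dist (zL (sp + δ)) b < 3 * ρ / 2 := by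
      have h1 : dist (zL (sp + δ)) b ^ 2 < (3 * ρ / 2) ^ 2 := by
        rw [hzb]
        have haa : a ^ 2 < ρ ^ 2 := by
          have := abs_lt.1 ha; nlinarith only [this, sq_abs a]
        have hss : (sp + δ) ^ 2 < ρ ^ 2 := by
          have := abs_lt.1 hs'ρ; nlinarith only [this]
        nlinarith only [haa, hss, hρ]
      exact (abs_lt_of_sq_lt_sq' h1 (by linarith)).2
    by_cases hnear : q ∈ closedBall b (5 * ρ)
    swap
    · rw [mem_closedBall, not_le] at hnear
      have := dist_triangle q (zL (sp + δ)) b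
      rw [dist_comm q (zL (sp + δ))] at this
      linarith
    by_cases hstrict : dist (zL sp) b < dist (zL sp) q
    · exact le_of_lt (mem_iInter₂.1 (hεU hs'U) q ⟨⟨hq, hnear⟩, hstrict⟩)
    have heq : dist (zL sp) q = dist (zL sp) b := le_antisymm (not_lt.1 hstrict) (hcell q hq)
    have hκ : ((q - c) * conj e).im ≤ 0 := H q hq heq
    set ζ : ℂ := (q - c) * conj e with hζ
    have hq' : q = c + ((ζ.re : ℂ) + ζ.im * Complex.I) * e := by
      rw [Complex.re_add_im]; exact eq_frame c e he q
    have hF : ∀ s : ℝ, dist (zL s) q ^ 2 - dist (zL s) b ^ 2 =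
        ζ.re ^ 2 + ζ.im ^ 2 - a ^ 2 - 2 * ζ.im * s := by
      intro s
      rw [hq', dist_bis_sq c e he, dist_bis_sub_sq c e he]; ring
    have h0 : dist (zL sp) q ^ 2 - dist (zL sp) b ^ 2 = 0 := by rw [heq]; ring
    have h1 : 0 ≤ dist (zL (sp + δ)) q ^ 2 - dist (zL (sp + δ)) b ^ 2 := by
      rw [hF] at h0 ⊢
      nlinarith only [h0, hδpos, hκ]
    exact (sq_le_sq₀ dist_nonneg dist_nonneg).1 (by linarith only [h1])
  have := le_csSup hbdd hs'S
  linarith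

/-- **Bottom blocker** (the top blocker in the reflected frame `(c, -e, -a)`): at the bottom
parameter `sInf S` some nucleus is tied with `b` and lies strictly BELOW the line `b b'`.
[folklore] -/
theorem exists_blocker_sInf {X : Set ℂ} {ρ a : ℝ} {c e : ℂ} (he : ‖e‖ = 1) (hρ : 0 < ρ)
    (ha : |a| < ρ) (hfin : (X ∩ closedBall (c - a * e) (5 * ρ)).Finite) (S : Set ℝ)
    (hS : S = {s : ℝ | c + ((s : ℂ) * Complex.I) * e ∈ voronoiCell X (c - a * e)})
    (hSρ : ∀ s ∈ S, |s| < ρ) (hne : S.Nonempty) (hcl : IsClosed S) :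
    ∃ q ∈ X, dist (c + (((sInf S : ℝ) : ℂ) * Complex.I) * e) q =
      dist (c + (((sInf S : ℝ) : ℂ) * Complex.I) * e) (c - a * e) ∧ ((q - c) * conj e).im < 0 := by
  have he' : ‖-e‖ = 1 := by rw [norm_neg, he]
  have ha' : |-a| < ρ := by rwa [abs_neg]
  have hb : c - (((-a : ℝ) : ℂ)) * (-e) = c - a * e := by push_cast; ring
  have hz : ∀ s : ℝ, c + ((s : ℂ) * Complex.I) * (-e) = c + (((-s : ℝ) : ℂ) * Complex.I) * e := by
    intro s; push_cast; ring
  have hS' : -S = {s : ℝ | c + ((s : ℂ) * Complex.I) * (-e) ∈ voronoiCell X (c - ((-a : ℝ) : ℂ) * (-e))} := by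
    ext s
    rw [Set.mem_neg, hS, mem_setOf_eq, mem_setOf_eq, hz, hb]
  obtain ⟨q, hqX, hqd, hqκ⟩ := exists_blocker_sSup (X := X) he' hρ ha' (by rw [hb]; exact hfin) (-S)
    hS' (fun s hs => by rw [← abs_neg]; exact hSρ (-s) (Set.mem_neg.1 hs)) hne.neg hcl.neg
  refine ⟨q, hqX, ?_, ?_⟩
  · rw [hz, hb, show -sSup (-S) = sInf S by rw [Real.sInf_def]] at hqd
    exact hqd
  · rw [map_neg, mul_neg, Complex.neg_im] at hqκ
    linarith

/-! ### The clearance inequality at the midpoint of an edge (pure real algebra) -/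

/-- **Clearance at the midpoint, normalised signs.**  In the frame, let the third nucleus have
coordinates `(t, κ)` with `t, κ ≥ 0`, let `[sm, sp] ⊆ (-ρ, ρ)` have length `≥ ℓ₀` with the
constraint `F(s) = t² + κ² - a² - 2κs ≥ 0` (nucleus not closer than `b`) at both ends, let the
nucleus be `≥ r₂` from `b' = (a, 0)` and let `D ≤ 8ρ` with `D² ≤ (t + a)² + κ²` (e.g.
`D = |qb|`).  Then under `4μ ≤ r₂`, `64μρ ≤ ℓ₀r₂` the midpoint has clearance `F ≥ 2μD`.  Three
regimes: `κ ≥ r₂/4` (slope times length), `t ≥ a` with small `κ` (the nucleus is beyond `b'`,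
`F(0)` is large and the slope is small), `t < a` with small `κ` (the nucleus sits between `b` and
`b'` below the axis; its pseudo-vertex lies below `sp - ℓ₀`, forcing a slope `≳ r₂ a/ρ`).
[folklore] -/
theorem door_core {a t κ sm sp ρ r₂ ℓ₀ μ D : ℝ} (ha : 0 < a) (ht : 0 ≤ t) (hκ : 0 ≤ κ)
    (hr₂ : 0 < r₂) (hℓ₀ : 0 < ℓ₀) (hμ : 0 < μ) (h4 : 4 * μ ≤ r₂)
    (h64 : 64 * μ * ρ ≤ ℓ₀ * r₂)
    (hsm : -ρ < sm) (hsp : sp < ρ) (hℓ : ℓ₀ ≤ sp - sm)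
    (hFm : 0 ≤ t ^ 2 + κ ^ 2 - a ^ 2 - 2 * κ * sm) (hFp : 0 ≤ t ^ 2 + κ ^ 2 - a ^ 2 - 2 * κ * sp)
    (hsep : r₂ ^ 2 ≤ (t - a) ^ 2 + κ ^ 2) (hD0 : 0 ≤ D) (hD8 : D ≤ 8 * ρ)
    (hD2 : D ^ 2 ≤ (t + a) ^ 2 + κ ^ 2) :
    2 * μ * D ≤ t ^ 2 + κ ^ 2 - a ^ 2 - 2 * κ * ((sm + sp) / 2) := by
  obtain ⟨Fmid, hFmid⟩ : ∃ F : ℝ, F = t ^ 2 + κ ^ 2 - a ^ 2 - 2 * κ * ((sm + sp) / 2) := ⟨_, rfl⟩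
  rw [← hFmid]
  have hkey : κ * ℓ₀ ≤ Fmid := by
    have h1 := mul_le_mul_of_nonneg_left hℓ hκ
    have e : Fmid = (t ^ 2 + κ ^ 2 - a ^ 2 - 2 * κ * sp) + κ * (sp - sm) := by rw [hFmid]; ring
    rw [e]; linarith only [h1, hFp]
  have hDle : D ≤ t + a + κ := by
    have h0 : 0 ≤ (t + a) * κ := mul_nonneg (add_nonneg ht ha.le) hκ
    have h1 : D ^ 2 ≤ (t + a + κ) ^ 2 := by nlinarith only [h0, hD2]
    exact (sq_le_sq₀ hD0 (by positivity)).1 h1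
  rcases le_or_gt (r₂ / 4) κ with hκ4 | hκ4
  · calc 2 * μ * D ≤ 2 * μ * (8 * ρ) := by gcongr
      _ = (64 * μ * ρ) / 4 := by ring
      _ ≤ (ℓ₀ * r₂) / 4 := by linarith only [h64]
      _ = (r₂ / 4) * ℓ₀ := by ring
      _ ≤ κ * ℓ₀ := mul_le_mul_of_nonneg_right hκ4 hℓ₀.le
      _ ≤ Fmid := hkey
  · have hκsq : κ ^ 2 < r₂ ^ 2 / 16 := by
      have := mul_self_lt_mul_self hκ hκ4
      nlinarith only [this]
    have h15 : (15 / 16) * r₂ ^ 2 < (t - a) ^ 2 := by linarith only [hκsq, hsep]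
    have hB : 64 * μ * ρ * κ ≤ r₂ * Fmid := by
      calc 64 * μ * ρ * κ ≤ ℓ₀ * r₂ * κ := mul_le_mul_of_nonneg_right h64 hκ
        _ = r₂ * (κ * ℓ₀) := by ring
        _ ≤ r₂ * Fmid := mul_le_mul_of_nonneg_left hkey hr₂.le
    rcases le_or_gt a t with hat | hat
    · have h78 : 7 / 8 * r₂ ≤ t - a := by
        by_contra hc
        have hc' : t - a < 7 / 8 * r₂ := lt_of_not_ge hc
        have := mul_self_lt_mul_self (sub_nonneg.2 hat) hc'
        nlinarith only [this, h15]
      have hA : (t - a) * (t + a) - 2 * κ * ρ ≤ Fmid := by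
        have e : Fmid = (t - a) * (t + a) + κ ^ 2 - κ * (sm + sp) := by rw [hFmid]; ring
        rw [e]
        have h1 := mul_le_mul_of_nonneg_left (by linarith only [hsp, hℓ, hℓ₀] : sm + sp ≤ 2 * ρ) hκ
        nlinarith only [h1, sq_nonneg κ]
      have hP : 7 / 8 * r₂ * (t + a) ≤ (t - a) * (t + a) :=
        mul_le_mul_of_nonneg_right h78 (by linarith only [ha, ht])
      have hC : 28 * μ * r₂ * (t + a) ≤ (r₂ + 32 * μ) * Fmid := by
        have h1 := mul_le_mul_of_nonneg_left hA (by linarith only [hμ] : (0:ℝ) ≤ 32 * μ)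
        have h2 := mul_le_mul_of_nonneg_left hP (by linarith only [hμ] : (0:ℝ) ≤ 32 * μ)
        nlinarith only [h1, h2, hB]
      have hpos : 0 < r₂ + 32 * μ := by positivity
      have hκta : κ ≤ 2 / 7 * (t + a) := by linarith only [hκ4, h78, ha]
      have hta : 0 ≤ t + a := by linarith only [ha, ht]
      have hfin : 2 * μ * D * (r₂ + 32 * μ) ≤ Fmid * (r₂ + 32 * μ) := by
        have h1 : 2 * μ * D * (r₂ + 32 * μ) ≤ 2 * μ * ((9 / 7) * (t + a)) * (9 * r₂) := by
          apply mul_le_mul _ (by linarith only [h4]) hpos.le (by positivity)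
          exact mul_le_mul_of_nonneg_left (by linarith only [hDle, hκta]) (by positivity)
        have h3 : 0 ≤ μ * r₂ * (t + a) := mul_nonneg (mul_nonneg hμ.le hr₂.le) hta
        nlinarith only [h1, h3, hC]
      exact le_of_mul_le_mul_right hfin hpos
    · have h78 : 7 / 8 * r₂ ≤ a - t := by
        by_contra hc
        have hc' : a - t < 7 / 8 * r₂ := lt_of_not_ge hc
        have := mul_self_lt_mul_self (sub_nonneg.2 hat.le) hc'
        nlinarith only [this, h15]
      have hE : (a - t) * (a + t) - κ ^ 2 ≤ 2 * κ * ρ := by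
        have h1 := mul_le_mul_of_nonneg_left (by linarith only [hsm] : -sm ≤ ρ)
          (by linarith only [hκ] : (0:ℝ) ≤ 2 * κ)
        nlinarith only [h1, hFm]
      have hC : 32 * μ * ((a - t) * (a + t) - κ ^ 2) ≤ r₂ * Fmid := by
        have h1 := mul_le_mul_of_nonneg_left hE (by linarith only [hμ] : (0:ℝ) ≤ 32 * μ)
        nlinarith only [h1, hB]
      have hta : 0 < a + t := by linarith only [ha, ht]
      have hr₂at : r₂ ≤ 8 / 7 * (a + t) := by linarith only [h78, ht]
      have hP : 7 / 8 * r₂ * (a + t) - r₂ * ((1 / 7) * (a + t)) ≤ (a - t) * (a + t) - κ ^ 2 := by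
        have h1 : 7 / 8 * r₂ * (a + t) ≤ (a - t) * (a + t) := mul_le_mul_of_nonneg_right h78 hta.le
        have h2 : κ ^ 2 ≤ r₂ * ((1 / 7) * (a + t)) := by
          calc κ ^ 2 ≤ r₂ ^ 2 / 16 := hκsq.le
            _ = r₂ * (r₂ / 16) := by ring
            _ ≤ r₂ * ((1 / 7) * (a + t)) :=
                mul_le_mul_of_nonneg_left (by linarith only [hr₂at, hta]) hr₂.le
        linarith only [h1, h2]
      have hκta : κ ≤ 2 / 7 * (a + t) := by linarith only [hκ4, h78, ht]
      have hfin : r₂ * (2 * μ * D) ≤ r₂ * Fmid := by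
        have h1 : r₂ * (2 * μ * D) ≤ r₂ * (2 * μ * ((9 / 7) * (a + t))) := by
          apply mul_le_mul_of_nonneg_left _ hr₂.le
          exact mul_le_mul_of_nonneg_left (by linarith only [hDle, hκta]) (by positivity)
        have h2 : 32 * μ * (7 / 8 * r₂ * (a + t) - r₂ * ((1 / 7) * (a + t))) ≤ r₂ * Fmid :=
          (mul_le_mul_of_nonneg_left hP (by linarith only [hμ] : (0:ℝ) ≤ 32 * μ)).trans hC
        have h3 : 0 ≤ μ * r₂ * (a + t) := mul_nonneg (mul_nonneg hμ.le hr₂.le) hta.le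
        nlinarith only [h1, h2, h3]
      exact le_of_mul_le_mul_left hfin hr₂

/-- **Clearance at the midpoint, arbitrary signs** (reduce to `door_core` by the reflections
`t ↦ -t` and `(κ, s) ↦ (-κ, -s)`); separation from both `b` and `b'` is assumed and `D² ≤
(|t| + a)² + κ²` covers both `D = |qb|` and `D = |qb'|`. [folklore] -/
theorem door_core' {a t κ sm sp ρ r₂ ℓ₀ μ D : ℝ} (ha : 0 < a) (hr₂ : 0 < r₂)
    (hℓ₀ : 0 < ℓ₀) (hμ : 0 < μ) (h4 : 4 * μ ≤ r₂) (h64 : 64 * μ * ρ ≤ ℓ₀ * r₂)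
    (hsm : -ρ < sm) (hsp : sp < ρ) (hℓ : ℓ₀ ≤ sp - sm)
    (hFm : 0 ≤ t ^ 2 + κ ^ 2 - a ^ 2 - 2 * κ * sm) (hFp : 0 ≤ t ^ 2 + κ ^ 2 - a ^ 2 - 2 * κ * sp)
    (hsep : r₂ ^ 2 ≤ (t - a) ^ 2 + κ ^ 2) (hsep' : r₂ ^ 2 ≤ (t + a) ^ 2 + κ ^ 2)
    (hD0 : 0 ≤ D) (hD8 : D ≤ 8 * ρ) (hD2 : D ^ 2 ≤ (|t| + a) ^ 2 + κ ^ 2) :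
    2 * μ * D ≤ t ^ 2 + κ ^ 2 - a ^ 2 - 2 * κ * ((sm + sp) / 2) := by
  have hsepa : r₂ ^ 2 ≤ (|t| - a) ^ 2 + κ ^ 2 := by
    rcases le_or_gt 0 t with h | h
    · rwa [abs_of_nonneg h]
    · rw [abs_of_neg h]; linarith only [hsep']
  have ht2 : |t| ^ 2 = t ^ 2 := sq_abs t
  rcases le_or_gt 0 κ with hk | hk
  · have := door_core (D := D) ha (abs_nonneg t) hk hr₂ hℓ₀ hμ h4 h64 hsm hsp hℓ
      (by rw [ht2]; exact hFm) (by rw [ht2]; exact hFp) hsepa hD0 hD8 hD2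
    rw [ht2] at this; exact this
  · have hκ2 : (-κ) ^ 2 = κ ^ 2 := by ring
    have := door_core (D := D) (sm := -sp) (sp := -sm) ha (abs_nonneg t) (neg_nonneg.2 hk.le) hr₂
      hℓ₀ hμ h4 h64 (by linarith only [hsp]) (by linarith only [hsm]) (by linarith only [hℓ])
      (by rw [ht2, hκ2]; linarith only [hFp]) (by rw [ht2, hκ2]; linarith only [hFm])
      (by rw [hκ2]; exact hsepa) hD0 hD8 (by rw [hκ2]; exact hD2)
    rw [ht2, hκ2] at this; linarith only [this]


/-- **Registered sub-goal `stub_fatTube_part2`**: the top blocker (= `exists_blocker_sSup`).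
[folklore] -/
theorem stub_fatTube_part2 : ∀ {X : Set ℂ} {ρ a : ℝ} {c e : ℂ}, ‖e‖ = 1 → 0 < ρ → |a| < ρ → (X ∩ closedBall (c - a * e) (5 * ρ)).Finite → ∀ S : Set ℝ, S = {s : ℝ | c + ((s : ℂ) * Complex.I) * e ∈ voronoiCell X (c - a * e)} → (∀ s ∈ S, |s| < ρ) → S.Nonempty → IsClosed S → ∃ q ∈ X, dist (c + (((sSup S : ℝ) : ℂ) * Complex.I) * e) q = dist (c + (((sSup S : ℝ) : ℂ) * Complex.I) * e) (c - a * e) ∧ 0 < ((q - c) * conj e).im :=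
  fun he hρ ha hfin S hS hSρ hne hcl => exists_blocker_sSup he hρ ha hfin S hS hSρ hne hcl

end Summit.CriticalPhenomena.CardyFormulaZ2.Cruxes.SquareFromVoronoiHub.VoronoiBlocks.Faithful

end
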